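import Literature.MathematicalPhysics.QuantumFieldTheory.Balaban1983to89.NodeOLettersOfWalksPerturbative
import Literature.MathematicalPhysics.QuantumFieldTheory.Balaban1983to89.B13JointWalkExpansionAlgebra

/-!
# `Balaban1983to89.B13ConditioningBlockWalks` — T. Bałaban, *Renormalization group approach to lattice gauge field
theories. II. Cluster expansions*, Commun. Math. Phys. **116** (1988) 1–22 [Balaban1988RG2Cluster], (2.5)–(2.7)
pp. 12–13 and (2.14) p. 15: THE CONDITIONING STEP IN THE WALKS CURRENCY — the three kernel slots of a (2.14)-term (the
term precision `A(σ,u) = Δ^{(k)}(Z₀,σ,𝐔,𝐉)`, the Γ-kernel's local factor `L = Z₀(C*Δ_k(σ)C)Z₀ᶜ` and full precision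
`P` with `(C^{(k)})^{1/2}(σ) = P^{−1/2}`) ARE THE BLOCKS OF ONE OPERATOR `K(σ,u) = C*Δ_k(σ,𝐔,𝐉)C` on the term's bond set
`Λ ⊕ C₀` (interior `Z₀`-bonds `inl`, exterior `Z₀ᶜ`-bonds `inr`), so that NODE A's per-term reference rung
`NodeOLettersOfWalksPerturbative.TermWalksRef 𝒦 r` (THREE joint walk expansions + TWO reference positivities + geometry)
follows from ONE joint walk expansion of `K` through the σ-region `X` and ONE reference positivity of `K(0,0)`

statement-level bookkeeping over published theorems with citation tags; kernel-checked compositions of tree theorems;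
nothing here is a claim about the Yang–Mills mass gap.

CITATION HEADER (held scan `paper:balaban1988-cmp116-rg-ii-cluster`, text layer pp. 12–17 read this session by the
filing seat).  (2.5) p. 12: *"Thus, we write the term corresponding to a domain Z₀ as ∫dμ_{C^{(k)}}(B′)|_{⟨B′,C\*Δ_kCB′⟩}
F(Z₀,B) = ∫dμ_{C^{(k)}}(B′) exp(−½⟨Z₀ᶜB′, C\*Δ_kCZ₀ᶜB′⟩ − ½⟨Z₀B, C\*Δ_kCZ₀B⟩ …) F(Z₀,B)"*; (2.6) pp. 12–13: *"In the
integral with respect to B′ we make the linear change of variables B′ = (C^{(k)})^{1/2}X. This yields … exp(−½⟨C\*Δ_kCZ₀ᶜ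
(C^{(k)})^{1/2}X, C^{(k)}(Z₀)C\*Δ_kCZ₀ᶜ(C^{(k)})^{1/2}X⟩)·∫dμ_{C^{(k)}(Z₀)}(B) exp(−⟨B, C\*Δ_kCZ₀ᶜ(C^{(k)})^{1/2}X⟩)
F(Z₀,B) = ∫dμ₀(X)G(Z₀, X, C^{(k)}(Z₀), (C^{(k)})^{1/2}, Δ_k), (2.6) where the last equality is a definition of the
function G, and the measure dμ₀."*; p. 13 ll. 14–23: *"For this class of localization domains we construct the
generalized random walk expansions. This construction was discussed in [13] for all operators determining Δ_k, and for
C^{(k)}(Z₀), but not for (C^{(k)})^{1/2}."*; (2.7) p. 13 (the resolvent integral for the square root); (2.14) p. 15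
with *"Γ_k(Z₀, σ(Z)) = C\*Δ_k(σ(Z))CZ₀ᶜ(C^{(k)})^{1/2}(σ(Z))"* and *"For the pair (U′, 0) the operators are symmetric, and
the measure is positive … The general case is handled by a perturbative argument."*  [13] =
[Balaban1985BackgroundPropagators] CMP **99** (1985) Thm 3.10 p. 416, Thm 3.12 p. 423.

WHY (cell `pub-ymgap`, D-0062 Track A, node N10 = [B13] Lemmas 1–3; seat `pub-ymgap-dag-n10-c` g3, row s1).  After
the n10-c lineage's sixteen modules the N10 record junctions (`Summit…N10AtRecord11B13Walks` ∕ `…WalksRef` ∕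
`…WalksRefHolo`, `B13NodeTorusWalksHolo.b13Leaf_twoTorus_uniformWalksAcrossRef*`) display NODE A's object content as
ONE hypothesis per term, `hwalks : TermWalksRef (𝒦 Z t) rf` — the reference datum of n10-b's
`NodeOLettersOfWalksPerturbative`: joint walk expansions of `L`, of `P` and of `A2`, `m₀`-positivity of `P(0,0)`,
`m_{A,0}`-positivity of `A2(0,0)`, far-ness and multiplicity of BOTH location maps.  Print's (2.5)–(2.6) say more: in
the tree's block model of the conditioning (`B13Sect2Statements` (2.5)–(2.6): `C*Δ_kC` = the block matrix
`(A, B; Bᵀ, D)` on interior ⊕ exterior bonds, `C^{(k)}(Z₀) = A⁻¹`, `T = (C^{(k)})^{1/2}` on the WHOLE bond set with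
`Tᵀ(C*Δ_kC)T = 1`, `Γ X = B·(Z₀ᶜ-part of TX)` = `B13Term214.Gamma214`) the three slots are read off ONE operator:
`A2 = K.toBlocks₁₁`, `P = K`, `L = fromCols 0 K.toBlocks₁₂`.  THIS FILE proves that under this reading the rung's five
analytic inputs follow from TWO about `K` — so that the producer of NODE A (cell GAPS G-B9-10 ∕ node N06 s4 ∕ row (D4):
[13] Thms 3.10∕3.12 for Bałaban's operators, s-decorated by (1.11) = `B13Eq111SDecoupling`, sandwiched by the real
local `C` = `B13JointWalkExpansionAlgebra.jointWalkExpansion_mul`) owes ONE expansion and ONE positivity per term, for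
print's single named operator `C*Δ_k(σ)C`.

WHAT THIS FILE PROVES (all `theorem`s; no `def`, no `structure`, no instance, no notation).
§1 `jointWalkExpansion_toBlocks₁₁` ∕ `jointWalkExpansion_offBlock` — a joint walk expansion of `K` on `Λ ⊕ C₀` (columns
   AND rows located by `locN`) is one of the interior block `(σ,u) ↦ (K σ u).toBlocks₁₁` and of the padded off-diagonal
   block `(σ,u) ↦ fromCols 0 (K σ u).toBlocks₁₂` (rows located by `locN ∘ inl`), with the SAME terms re-read, the same
   σ-carrying sub-family, amplitudes, walk distances, rates and constant (every field is entrywise; the zero columns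
   are bounded by any non-negative majorant).
§2 `refAcc_toBlocks₁₁` — `m`-positivity of `Re K₀` on `Λ ⊕ C₀` gives `m`-positivity of `Re K₀.toBlocks₁₁` on `Λ`
   (test vectors extended by zero); (private) `card_filter_comp_inl_le` — the multiplicity of `locN ∘ inl` is at most
   that of `locN`.
§3 ★ `termWalksRef_of_conditionedBlocks` — for kernel data `𝒦 : TermKernels` READ IN BLOCK FORM (`hA2 : 𝒦.A2 σ u =
   (K σ u).toBlocks₁₁`, `hG2 : 𝒦.G2 σ u = fromCols 0 (K σ u).toBlocks₁₂ * invSqrt (K σ u)`, `hloc : 𝒦.locΛ = 𝒦.locN ∘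
   inl`), `X ≠ ∅`, ONE `JointWalkExpansion c 𝒦.locN 𝒦.locN K 𝒦.X R ε κ K̄ …` (`K̄ ≥ 0`), `m`-positivity of
   `Re K(0,0)`, far-ness `R_σ` and multiplicity `n_B` of `locN`, torus dimension `≤ d_m`, and ANY reference package `r`
   DOMINATED by `(R, ε, κ, K̄, m, R_σ, n_B, d_m)` in all three slots ⟹ `TermWalksRef 𝒦 r` (`JointWalkExpansion.mono`
   slot by slot).  `uniformWalksAcrossRef_of_conditionedBlocks` — the same across a family `𝓣 : S → TorusTerms c d`
   ⟹ `UniformWalksAcrossRef 𝓣 r`, the hypothesis of `uniformWalksAcross_of_ref` ∕ `acrossSmall_of_ref_thresholds` ∕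
   `B13NodeTorusWalksHolo.b13Leaf_twoTorus_uniformWalksAcrossRefHolo` BY NAME.
§4 The structural letters of the record junctions from `K`: `isSymm_toBlocks₁₁` (`hAs`: complex symmetry of `A2(σ,u)`
   from that of `K(σ,u)`), `differentiableOn_toBlocks₁₁_apply` (`hAhol`),
   `differentiableOn_offBlock_mul_invSqrt_apply` (`hGhol`: σ-holomorphy of the Γ-kernel `fromCols 0 K.toBlocks₁₂ ·
   invSqrt K` on a σ-ball from entrywise σ-holomorphy of `K` and ONE uniform accretivity constant `m > 0`, by
   `B13Sqrt27Accretive.differentiableOn_invSqrt_apply` in the σ-variable), `setOf_forall_mem_ball_eq_ball` (the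
   junctions' open polydisc `{σ | ∀ j, σ j ∈ ball 0 ϱ}` IS the sup-norm ball, `Metric.ball_pi`).
§5 At the letters of ONE reference package `rf` (the consumer forms for the record junctions):
   `termWalksRef_of_conditionedBlocks_at` (expansion of `K` at `rf`'s full-precision letters, the other two slots
   dominated by it) and `accretive_of_conditionedBlocks_at` (`Re K(σ,u) ≥ m₀/2` on the closed polydisc × `R₁`-ball from
   the ONE expansion + reference positivity under print's two perturbative thresholds — the uniform accretivity the
   `hGhol` derivation consumes; `volume_of_multiplicity` + `margin_of_thresholds` + `accretive_of_jointWalkExpansion_far`).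
HONEST FRAMING: kernel-level bookkeeping (finite matrices, block algebra, one dominated-convergence holomorphy by name).
Print decorates the three operator arguments of `G` in (2.8) p. 14 SEPARATELY; the tree's (2.14) reading
(`NodeOLettersOfWalksAcross.TermWalks.product`: `G2 = L·invSqrt P`; `B13Term214.core214`: covariance `(A σ)⁻¹`) takes
inverse and square root AFTER decoration, and under THAT declared reading the block form is literal.  NOTHING of
Bałaban's `C*Δ_k(σ,𝐔,𝐉)C` is constructed or asserted — whether it carries ONE joint walk expansion with k-, history-
and torus-uniform constants at complex backgrounds, positive at `(U′,0)`, is NODE A's object content ([13] Thms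
3.10∕3.12, (1.11); cell GAPS G-B9-10; node N06 s4 ∕ row (D4)) and stays the INPUT; count-neutral Track-A side landing;
NOT a discharge of N10; no `sorry`, no new named fact; standard axioms; one finite T⁴ programme at fixed ε — NOT [B12]
Thm 2, NOT continuum ∕ ℝ⁴ ∕ OS ∕ mass gap ∕ Clay.
-/

noncomputable section

namespace Literature.MathematicalPhysics.QuantumFieldTheory.Balaban1983to89.B13ConditioningBlockWalks

open Metric Set Finset
open scoped Matrix
open Literature.MathematicalPhysics.QuantumFieldTheory.Balaban1983to89
open Literature.MathematicalPhysics.QuantumFieldTheory.Balaban1983to89.B9Thm34Ext (toB6)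
open Literature.MathematicalPhysics.QuantumFieldTheory.Balaban1983to89.B9Thm37GlueTorus (torusGeom tdist1 tdist1_nonneg)
open Literature.MathematicalPhysics.QuantumFieldTheory.Balaban1983to89.TreeLengthTorus (TPt)
open Literature.MathematicalPhysics.QuantumFieldTheory.Balaban1983to89.B5TorusCover (UT)
open Literature.MathematicalPhysics.QuantumFieldTheory.Balaban1983to89.B13JointWalkExpansion (JointWalkExpansion)
open Literature.MathematicalPhysics.QuantumFieldTheory.Balaban1983to89.B13TermWalkData (TermKernels TorusTerms)
open Literature.MathematicalPhysics.QuantumFieldTheory.Balaban1983to89.B13Sqrt27Accretive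
  (invSqrt differentiableOn_invSqrt_apply)
open Literature.MathematicalPhysics.QuantumFieldTheory.Balaban1983to89.NodeOLettersOfWalksPerturbative
  (RefPackage TermWalksRef UniformWalksAcrossRef)

variable {d N' : ℕ} {ν : ℕ} {Nf : Fin ν → ℕ} [∀ i, NeZero (Nf i)]
variable {E : Type*} [NormedAddCommGroup E] [NormedSpace ℂ E]

/-! ## §1. One joint walk expansion of `K` on `Λ ⊕ C₀` gives those of its interior block and of its padded
off-diagonal block -/

section Blocks

variable {Λ C₀ : Type} {c : B13.Consts} {locN : Λ ⊕ C₀ → UT Nf}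
variable {K : (TPt d N' → ℂ) → E → Matrix (Λ ⊕ C₀) (Λ ⊕ C₀) ℂ} {X : Finset (UT Nf)} {R ε kap Kbar : ℝ}
variable {W : Type} {T : W → (TPt d N' → ℂ) → E → Matrix (Λ ⊕ C₀) (Λ ⊕ C₀) ℂ} {SX : Set W} {A : W → ℝ}
variable {D : W → UT Nf → UT Nf → ℝ} {ρ : ℝ}

/-- Entries of the interior block. [folklore] -/
private theorem toBlocks₁₁_apply_eq (M : Matrix (Λ ⊕ C₀) (Λ ⊕ C₀) ℂ) (i j : Λ) :
    M.toBlocks₁₁ i j = M (Sum.inl i) (Sum.inl j) := rfl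

/-- The interior columns of the padded off-diagonal block `fromCols 0 M.toBlocks₁₂` vanish. [folklore] -/
private theorem offBlock_apply_inl (M : Matrix (Λ ⊕ C₀) (Λ ⊕ C₀) ℂ) (i j : Λ) :
    Matrix.fromCols (0 : Matrix Λ Λ ℂ) M.toBlocks₁₂ i (Sum.inl j) = 0 := rfl

/-- The exterior columns of the padded off-diagonal block `fromCols 0 M.toBlocks₁₂` are the entries `M (inl i) (inr j)`
(print: the block `Z₀(C\*Δ_kC)Z₀ᶜ`). [cite: Balaban1988RG2Cluster, (2.5)–(2.6) pp.12–13] -/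
theorem offBlock_apply_inr (M : Matrix (Λ ⊕ C₀) (Λ ⊕ C₀) ℂ) (i : Λ) (j : C₀) :
    Matrix.fromCols (0 : Matrix Λ Λ ℂ) M.toBlocks₁₂ i (Sum.inr j) = M (Sum.inl i) (Sum.inr j) := rfl

/-- **THE INTERIOR BLOCK** `(σ,u) ↦ (K σ u).toBlocks₁₁` (print: `Z₀(C\*Δ_k(σ)C)Z₀ = Δ^{(k)}(Z₀,σ)`, the precision of
`dμ_{C^{(k)}(Z₀,σ)}`) of a joint walk expansion of `K` is a joint walk expansion with the same terms re-read, rows and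
columns located by `locN ∘ inl`, and the same constants — every field is entrywise
(cf. `B13JointWalkExpansionAlgebra.jointWalkExpansion_submatrix`). [cite: Balaban1988RG2Cluster, (2.5) p.12, p.13; Balaban1985BackgroundPropagators, (3.107)–(3.108) p.416] -/
theorem jointWalkExpansion_toBlocks₁₁ (h : JointWalkExpansion c locN locN K X R ε kap Kbar T SX A D ρ) :
    JointWalkExpansion c (locN ∘ Sum.inl) (locN ∘ Sum.inl) (fun σ u => (K σ u).toBlocks₁₁) X R ε kap Kbar
      (fun ω σ u => (T ω σ u).toBlocks₁₁) SX A D ρ where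
  hasSum σ hσ u hu i j := by
    simp only [toBlocks₁₁_apply_eq]
    exact h.hasSum σ hσ u hu (Sum.inl i) (Sum.inl j)
  termAnalytic ω σ hσ i j := by
    simp only [toBlocks₁₁_apply_eq]
    exact h.termAnalytic ω σ hσ (Sum.inl i) (Sum.inl j)
  maj ω σ hσ u hu i j := by
    simp only [toBlocks₁₁_apply_eq, Function.comp_apply]
    exact h.maj ω σ hσ u hu (Sum.inl i) (Sum.inl j)
  majSum := h.majSum
  indep ω hω σ hσ := by
    show (T ω σ 0).toBlocks₁₁ = (T ω 0 0).toBlocks₁₁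
    rw [h.indep ω hω σ hσ]
  through := h.through
  A_nonneg := h.A_nonneg
  D_nonneg := h.D_nonneg

/-- **THE PADDED OFF-DIAGONAL BLOCK** `(σ,u) ↦ fromCols 0 (K σ u).toBlocks₁₂` (print: the local factor
`Z₀(C\*Δ_k(σ)C)Z₀ᶜ` of `Γ_k(Z₀,σ)`, read as a kernel from the whole bond set `Λ ⊕ C₀` into the interior bonds with
vanishing interior columns) of a joint walk expansion of `K` is a joint walk expansion with the same terms re-read,
rows located by `locN ∘ inl`, columns by `locN`, and the same constants: the zero columns are summed trivially,
analytic as constants, and bounded by the (non-negative) walk majorants. [cite: Balaban1988RG2Cluster, (2.5)–(2.6) pp.12–13, (2.14) p.15; Balaban1985BackgroundPropagators, (3.107)–(3.108) p.416] -/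
theorem jointWalkExpansion_offBlock (h : JointWalkExpansion c locN locN K X R ε kap Kbar T SX A D ρ) :
    JointWalkExpansion c (locN ∘ Sum.inl) locN (fun σ u => Matrix.fromCols (0 : Matrix Λ Λ ℂ) (K σ u).toBlocks₁₂)
      X R ε kap Kbar (fun ω σ u => Matrix.fromCols (0 : Matrix Λ Λ ℂ) (T ω σ u).toBlocks₁₂) SX A D ρ where
  hasSum σ hσ u hu i j := by
    cases j with
    | inl j =>
      simp only [offBlock_apply_inl]
      exact hasSum_zero
    | inr j =>
      simp only [offBlock_apply_inr]
      exact h.hasSum σ hσ u hu (Sum.inl i) (Sum.inr j)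
  termAnalytic ω σ hσ i j := by
    cases j with
    | inl j =>
      simp only [offBlock_apply_inl]
      exact differentiableOn_const _
    | inr j =>
      simp only [offBlock_apply_inr]
      exact h.termAnalytic ω σ hσ (Sum.inl i) (Sum.inr j)
  maj ω σ hσ u hu i j := by
    cases j with
    | inl j =>
      simp only [offBlock_apply_inl, norm_zero]
      exact mul_nonneg (h.A_nonneg ω) (Real.exp_pos _).le
    | inr j =>
      simp only [offBlock_apply_inr, Function.comp_apply]
      exact h.maj ω σ hσ u hu (Sum.inl i) (Sum.inr j)
  majSum := h.majSum
  indep ω hω σ hσ := by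
    show Matrix.fromCols (0 : Matrix Λ Λ ℂ) (T ω σ 0).toBlocks₁₂ = Matrix.fromCols (0 : Matrix Λ Λ ℂ) (T ω 0 0).toBlocks₁₂
    rw [h.indep ω hω σ hσ]
  through := h.through
  A_nonneg := h.A_nonneg
  D_nonneg := h.D_nonneg

end Blocks

/-! ## §2. Reference positivity and multiplicity pass to the interior block -/

section Reference

variable {Λ C₀ : Type} [Fintype Λ] [Fintype C₀]

/-- **POSITIVITY OF THE INTERIOR BLOCK** (print p. 15: *"For the pair (U′, 0) the operators are symmetric, and the
measure is positive"* — the reference positivity of `Δ^{(k)}(Z₀, 0) = Z₀(C\*Δ_kC)Z₀` is that of `C\*Δ_kC` on vectors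
supported in `Z₀`): if `Re K₀ ≥ m` on `Λ ⊕ C₀` then `Re K₀.toBlocks₁₁ ≥ m` on `Λ` (test vectors extended by zero).
[cite: Balaban1988RG2Cluster, (2.5) p.12, p.15] -/
theorem refAcc_toBlocks₁₁ (K₀ : Matrix (Λ ⊕ C₀) (Λ ⊕ C₀) ℂ) {m : ℝ}
    (h : ∀ v : Λ ⊕ C₀ → ℂ, m * ∑ i, ‖v i‖ ^ 2 ≤ (∑ i, star (v i) * (K₀ *ᵥ v) i).re) (w : Λ → ℂ) :
    m * ∑ i, ‖w i‖ ^ 2 ≤ (∑ i, star (w i) * (K₀.toBlocks₁₁ *ᵥ w) i).re := by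
  have key := h (Sum.elim w 0)
  have h1 : ∑ i, ‖Sum.elim w (0 : C₀ → ℂ) i‖ ^ 2 = ∑ i, ‖w i‖ ^ 2 := by
    rw [Fintype.sum_sum_type]
    simp
  have h2 : ∑ i, star (Sum.elim w (0 : C₀ → ℂ) i) * (K₀ *ᵥ Sum.elim w 0) i
      = ∑ i, star (w i) * (K₀.toBlocks₁₁ *ᵥ w) i := by
    rw [Fintype.sum_sum_type]
    simp [Matrix.mulVec, dotProduct, Fintype.sum_sum_type, toBlocks₁₁_apply_eq]
  rw [h1, h2] at key
  exact key

variable {ν' : ℕ} {Nf' : Fin ν' → ℕ}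

/-- The multiplicity of the restricted location map `locN ∘ inl` is at most that of `locN` (the interior bonds are
among all bonds). [folklore] -/
private theorem card_filter_comp_inl_le (locN : Λ ⊕ C₀ → UT Nf') (x : UT Nf') :
    (Finset.univ.filter fun b : Λ => locN (Sum.inl b) = x).card
      ≤ (Finset.univ.filter fun k : Λ ⊕ C₀ => locN k = x).card := by
  rw [← Finset.card_map ⟨Sum.inl, Sum.inl_injective⟩]
  refine Finset.card_le_card fun k hk => ?_
  simp only [Finset.mem_map, Finset.mem_filter, Finset.mem_univ, true_and, Function.Embedding.coeFn_mk] at hk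
  obtain ⟨b, hb, rfl⟩ := hk
  simpa using hb

end Reference

/-! ## §3. The reference rung of a term from ONE expansion and ONE positivity of the conditioned operator -/

section Rung

variable {c : B13.Consts}

set_option maxHeartbeats 400000 in
/-- **NODE A's PER-TERM REFERENCE RUNG FROM THE CONDITIONING BLOCKS.**  Let the kernel data `𝒦` of a (2.14)-term be
READ IN BLOCK FORM off one operator family `K(σ,u)` on the term's bond set `Λ ⊕ C₀` (print: `K = C\*Δ_k(σ,𝐔,𝐉)C`;
interior `Z₀`-bonds `inl`, exterior `inr`): the term precision is the interior block (`hA2`), the Γ-kernel is the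
padded off-diagonal block times `K^{−1/2}` (`hG2`, the tree's (2.7)-reading `invSqrt`; `B13Term214.Gamma214`), the
interior rows sit where the interior columns sit (`hloc`).  Then `X ≠ ∅`, ONE joint walk expansion of `K` through `X`
on the `R`-ball with drop `ε`, torus rate `κ` and constant `K̄ ≥ 0` ([13] Thm 3.10 for the operators determining `Δ_k`,
s-decorated — NOT supplied here), `m`-positivity of `Re K(0,0)` (print: positivity at `(U′,0)`), far-ness `≥ R_σ` of
the bond locations from `X`, multiplicity `≤ n_B` of the location map and torus dimension `≤ d_m` give the reference
datum `TermWalksRef 𝒦 r` for EVERY reference package `r` dominated by these letters: `r.R ≤ R`; `r.ε_• ≤ ε`,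
`r.κ_• ≤ κ`, `K̄ ≤ r.K̄_•` in the three slots `• = L, P, A`; `r.m₀, r.m_{A,0} ≤ m`; `r.R_σ ≤ R_σ`; `n_B ≤ r.n_B`;
`d_m ≤ r.d_m`.  The three expansions are §1 (`P = K` itself) weakened by `JointWalkExpansion.mono`; the positivity of
`A2(0,0)` is `refAcc_toBlocks₁₁`; far-ness and multiplicity of `locΛ = locN ∘ inl` are those of `locN`.  NOTHING of
Bałaban's operator is constructed: its one expansion and positivity are the displayed INPUT.
[cite: Balaban1988RG2Cluster, (2.5)–(2.7) pp.12–13, (2.14) p.15, (2.16) p.16; Balaban1985BackgroundPropagators, Thm 3.10 p.416, Thm 3.12 p.423] -/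
theorem termWalksRef_of_conditionedBlocks {𝒦 : TermKernels c d N' ν Nf E} [Fintype 𝒦.C₀] [DecidableEq 𝒦.C₀]
    {K : (TPt d N' → ℂ) → E → Matrix (𝒦.Λ ⊕ 𝒦.C₀) (𝒦.Λ ⊕ 𝒦.C₀) ℂ}
    -- the block reading (2.5)–(2.6) of the term's three kernels
    (hA2 : ∀ σ u, 𝒦.A2 σ u = (K σ u).toBlocks₁₁)
    (hG2 : ∀ σ u, 𝒦.G2 σ u = Matrix.fromCols (0 : Matrix 𝒦.Λ 𝒦.Λ ℂ) (K σ u).toBlocks₁₂ * invSqrt (K σ u))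
    (hloc : ∀ i, 𝒦.locΛ i = 𝒦.locN (Sum.inl i))
    (hX : 𝒦.X.Nonempty)
    -- ONE joint walk expansion of `K` through `X`
    {R ε kap Kbar : ℝ} {W : Type} {T : W → (TPt d N' → ℂ) → E → Matrix (𝒦.Λ ⊕ 𝒦.C₀) (𝒦.Λ ⊕ 𝒦.C₀) ℂ}
    {SX : Set W} {A : W → ℝ} {D : W → UT Nf → UT Nf → ℝ} {ρ : ℝ}
    (hK : JointWalkExpansion c 𝒦.locN 𝒦.locN K 𝒦.X R ε kap Kbar T SX A D ρ) (hKbar : 0 ≤ Kbar)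
    -- ONE reference positivity: `Re K(0,0) ≥ m`
    {m : ℝ} (hacc : ∀ v : 𝒦.Λ ⊕ 𝒦.C₀ → ℂ, m * ∑ i, ‖v i‖ ^ 2 ≤ (∑ i, star (v i) * (K 0 0 *ᵥ v) i).re)
    -- geometry of the ONE location map
    {Rσ : ℝ} (hfar : ∀ k : 𝒦.Λ ⊕ 𝒦.C₀, ∀ z ∈ 𝒦.X, Rσ ≤ tdist1 Nf (𝒦.locN k) z)
    {nB : ℕ} (hmult : ∀ x : UT Nf, (Finset.univ.filter fun k : 𝒦.Λ ⊕ 𝒦.C₀ => 𝒦.locN k = x).card ≤ nB)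
    {dm : ℕ} (hdim : ν ≤ dm)
    -- any reference package dominated by the letters above
    (r : RefPackage) (hrR : r.R ≤ R)
    (hεL : r.εL ≤ ε) (hκL : r.kapL ≤ kap) (hKL : Kbar ≤ r.KbarL)
    (hεP : r.εP ≤ ε) (hκP : r.kapP ≤ kap) (hKP : Kbar ≤ r.KbarP)
    (hεA : r.εA ≤ ε) (hκA : r.kapA ≤ kap) (hKA : Kbar ≤ r.KbarA)
    (hm₀ : r.m₀ ≤ m) (hmA : r.mA₀ ≤ m) (hRσ : r.Rσ ≤ Rσ) (hnB : nB ≤ r.nB) (hdm : dm ≤ r.dm) :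
    TermWalksRef 𝒦 r := by
  have hl : 𝒦.locΛ = 𝒦.locN ∘ Sum.inl := funext hloc
  have hA : 𝒦.A2 = fun σ u => (K σ u).toBlocks₁₁ := funext fun σ => funext fun u => hA2 σ u
  -- (1) the local factor `L = fromCols 0 K.toBlocks₁₂`
  have hJL : JointWalkExpansion c 𝒦.locΛ 𝒦.locN
      (fun σ u => Matrix.fromCols (0 : Matrix 𝒦.Λ 𝒦.Λ ℂ) (K σ u).toBlocks₁₂) 𝒦.X r.R r.εL r.kapL r.KbarL
      (fun ω σ u => Matrix.fromCols (0 : Matrix 𝒦.Λ 𝒦.Λ ℂ) (T ω σ u).toBlocks₁₂) SX A D ρ := by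
    rw [hl]
    exact (jointWalkExpansion_offBlock hK).mono hrR hεL hκL hKbar hKL
  -- (2) the full precision `P = K`
  have hJP : JointWalkExpansion c 𝒦.locN 𝒦.locN K 𝒦.X r.R r.εP r.kapP r.KbarP T SX A D ρ :=
    hK.mono hrR hεP hκP hKbar hKP
  -- (3) the term precision `A2 = K.toBlocks₁₁`
  have hJA : JointWalkExpansion c 𝒦.locΛ 𝒦.locΛ 𝒦.A2 𝒦.X r.R r.εA r.kapA r.KbarA
      (fun ω σ u => (T ω σ u).toBlocks₁₁) SX A D ρ := by
    rw [hl, hA]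
    exact (jointWalkExpansion_toBlocks₁₁ hK).mono hrR hεA hκA hKbar hKA
  -- (4) the two reference positivities
  have hS : ∀ {ι : Type} [Fintype ι] (v : ι → ℂ), 0 ≤ ∑ i, ‖v i‖ ^ 2 :=
    fun v => Finset.sum_nonneg fun i _ => by positivity
  have hPacc : ∀ v : 𝒦.Λ ⊕ 𝒦.C₀ → ℂ, r.m₀ * ∑ i, ‖v i‖ ^ 2 ≤ (∑ i, star (v i) * (K 0 0 *ᵥ v) i).re :=
    fun v => (mul_le_mul_of_nonneg_right hm₀ (hS v)).trans (hacc v)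
  have hAacc : ∀ v : 𝒦.Λ → ℂ, r.mA₀ * ∑ i, ‖v i‖ ^ 2 ≤ (∑ i, star (v i) * (𝒦.A2 0 0 *ᵥ v) i).re := by
    intro v
    rw [hA2]
    exact (mul_le_mul_of_nonneg_right hmA (hS v)).trans (refAcc_toBlocks₁₁ (K 0 0) hacc v)
  exact
    { nonempty := hX
      product := ⟨_, K, hG2, ⟨W, _, SX, A, D, ρ, hJL⟩, ⟨W, T, SX, A, D, ρ, hJP⟩, hPacc⟩
      precision := ⟨W, _, SX, A, D, ρ, hJA⟩
      refAccA := hAacc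
      far := fun b z hz => by rw [hloc b]; exact hRσ.trans (hfar (Sum.inl b) z hz)
      farN := fun k z hz => hRσ.trans (hfar k z hz)
      multΛ := fun x => by
        have h1 : (Finset.univ.filter fun b : 𝒦.Λ => 𝒦.locΛ b = x)
            = Finset.univ.filter fun b : 𝒦.Λ => 𝒦.locN (Sum.inl b) = x := by
          simp only [hloc]
        rw [h1]
        exact ((card_filter_comp_inl_le 𝒦.locN x).trans (hmult x)).trans hnB
      multN := fun x => (hmult x).trans hnB
      dim := hdim.trans hdm }

/-- **THE REFERENCE RUNG ACROSS A FAMILY FROM THE CONDITIONING BLOCKS**: if every term `i` of every member `𝓣 s`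
(`s` = (scale, history, torus, domain)) is read in block form off one operator `K_{s,i}` carrying ONE joint walk
expansion with the family-UNIFORM letters `(R, ε, κ, K̄)`, `m`-positivity of `Re K_{s,i}(0,0)`, far-ness `R_σ`,
multiplicity `n_B` and torus dimension `≤ d_m`, then `UniformWalksAcrossRef 𝓣 r` for every reference package `r`
dominated by these letters — the hypothesis of `NodeOLettersOfWalksPerturbative.uniformWalksAcross_of_ref` ∕
`acrossSmall_of_ref_thresholds` and of the N10 leaves `B13NodeTorusWalksHolo.b13Leaf_twoTorus_uniformWalksAcrossRef*`,
BY NAME.  The per-member data (extra-column instances, the operator, its expansion) are `∃`-bound; only the letters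
are exposed.  NOT supplied: this datum for BAŁABAN's family.
[cite: Balaban1988RG2Cluster, (2.5)–(2.7) pp.12–13, p.15; Balaban1985BackgroundPropagators, Thm 3.10 p.416, Thm 3.12 p.423] -/
theorem uniformWalksAcrossRef_of_conditionedBlocks {S : Type*} {𝓣 : S → TorusTerms c d}
    {R ε kap Kbar m Rσ : ℝ} {nB dm : ℕ} (hKbar : 0 ≤ Kbar)
    (h : ∀ s, ∀ i : (𝓣 s).ι, ∃ (_ : Fintype ((𝓣 s).𝒦 i).C₀) (_ : DecidableEq ((𝓣 s).𝒦 i).C₀)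
      (K : (TPt d (𝓣 s).N' → ℂ) → (𝓣 s).E → Matrix (((𝓣 s).𝒦 i).Λ ⊕ ((𝓣 s).𝒦 i).C₀) (((𝓣 s).𝒦 i).Λ ⊕ ((𝓣 s).𝒦 i).C₀) ℂ),
      (∀ σ u, ((𝓣 s).𝒦 i).A2 σ u = (K σ u).toBlocks₁₁) ∧
      (∀ σ u, ((𝓣 s).𝒦 i).G2 σ u
        = Matrix.fromCols (0 : Matrix ((𝓣 s).𝒦 i).Λ ((𝓣 s).𝒦 i).Λ ℂ) (K σ u).toBlocks₁₂ * invSqrt (K σ u)) ∧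
      (∀ j, ((𝓣 s).𝒦 i).locΛ j = ((𝓣 s).𝒦 i).locN (Sum.inl j)) ∧
      ((𝓣 s).𝒦 i).X.Nonempty ∧
      (∃ (W : Type) (T : W → (TPt d (𝓣 s).N' → ℂ) → (𝓣 s).E →
          Matrix (((𝓣 s).𝒦 i).Λ ⊕ ((𝓣 s).𝒦 i).C₀) (((𝓣 s).𝒦 i).Λ ⊕ ((𝓣 s).𝒦 i).C₀) ℂ)
          (SX : Set W) (A : W → ℝ) (D : W → UT (𝓣 s).Nf → UT (𝓣 s).Nf → ℝ) (ρ : ℝ),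
          JointWalkExpansion c ((𝓣 s).𝒦 i).locN ((𝓣 s).𝒦 i).locN K ((𝓣 s).𝒦 i).X R ε kap Kbar T SX A D ρ) ∧
      (∀ v : ((𝓣 s).𝒦 i).Λ ⊕ ((𝓣 s).𝒦 i).C₀ → ℂ,
        m * ∑ l, ‖v l‖ ^ 2 ≤ (∑ l, star (v l) * (K 0 0 *ᵥ v) l).re) ∧
      (∀ k, ∀ z ∈ ((𝓣 s).𝒦 i).X, Rσ ≤ tdist1 (𝓣 s).Nf (((𝓣 s).𝒦 i).locN k) z) ∧
      (∀ x, (Finset.univ.filter fun k => ((𝓣 s).𝒦 i).locN k = x).card ≤ nB) ∧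
      (𝓣 s).ν ≤ dm)
    (r : RefPackage) (hrR : r.R ≤ R)
    (hεL : r.εL ≤ ε) (hκL : r.kapL ≤ kap) (hKL : Kbar ≤ r.KbarL)
    (hεP : r.εP ≤ ε) (hκP : r.kapP ≤ kap) (hKP : Kbar ≤ r.KbarP)
    (hεA : r.εA ≤ ε) (hκA : r.kapA ≤ kap) (hKA : Kbar ≤ r.KbarA)
    (hm₀ : r.m₀ ≤ m) (hmA : r.mA₀ ≤ m) (hRσ : r.Rσ ≤ Rσ) (hnB : nB ≤ r.nB) (hdm : dm ≤ r.dm) :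
    UniformWalksAcrossRef 𝓣 r := by
  intro s i
  obtain ⟨instF, instD, K, hA2, hG2, hloc, hX, ⟨W, T, SX, A, D, ρ, hK⟩, hacc, hfar, hmult, hdim⟩ := h s i
  exact ⟨instF, instD, termWalksRef_of_conditionedBlocks hA2 hG2 hloc hX hK hKbar hacc hfar hmult hdim r hrR
    hεL hκL hKL hεP hκP hKP hεA hκA hKA hm₀ hmA hRσ hnB hdm⟩

end Rung

/-! ## §4. The structural letters of the record junctions, read off `K` -/

section Letters

variable {Λ C₀ : Type}

/-- **COMPLEX SYMMETRY OF THE TERM PRECISION FROM THAT OF `K`** (the `hAs` letter of the N10 record junctions; print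
p. 15: the operators are complexifications of symmetric ones): the interior block of a symmetric matrix is symmetric.
[cite: Balaban1988RG2Cluster, (2.14) p.15] -/
theorem isSymm_toBlocks₁₁ {M : Matrix (Λ ⊕ C₀) (Λ ⊕ C₀) ℂ} (h : M.IsSymm) : M.toBlocks₁₁.IsSymm := by
  ext i j
  simp only [Matrix.transpose_apply, toBlocks₁₁_apply_eq]
  exact h.apply (Sum.inl i) (Sum.inl j)

variable {P : Type*} [NormedAddCommGroup P] [NormedSpace ℂ P]

/-- **σ-HOLOMORPHY OF THE TERM PRECISION FROM THAT OF `K`** (the `hAhol` letter): the entries of the interior block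
of an entrywise holomorphic family are holomorphic. [cite: Balaban1988RG2Cluster, (2.14) p.15] -/
theorem differentiableOn_toBlocks₁₁_apply {K : P → Matrix (Λ ⊕ C₀) (Λ ⊕ C₀) ℂ} {U : Set P}
    (hK : ∀ k l, DifferentiableOn ℂ (fun σ => K σ k l) U) (i j : Λ) :
    DifferentiableOn ℂ (fun σ => (K σ).toBlocks₁₁ i j) U := by
  simp only [toBlocks₁₁_apply_eq]
  exact hK (Sum.inl i) (Sum.inl j)

variable [Fintype Λ] [Fintype C₀]

/-- Entries of the product of two entrywise holomorphic matrix families are holomorphic (finite sums of products).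
[folklore] -/
private theorem differentiableOn_fromCols_mul_apply {L : P → Matrix Λ (Λ ⊕ C₀) ℂ} {Q : P → Matrix (Λ ⊕ C₀) (Λ ⊕ C₀) ℂ}
    {U : Set P} (hL : ∀ i k, DifferentiableOn ℂ (fun σ => L σ i k) U)
    (hQ : ∀ k j, DifferentiableOn ℂ (fun σ => Q σ k j) U) (i : Λ) (j : Λ ⊕ C₀) :
    DifferentiableOn ℂ (fun σ => (L σ * Q σ) i j) U := by
  have e : (fun σ => (L σ * Q σ) i j) = fun σ => ∑ k, L σ i k * Q σ k j := funext fun σ => Matrix.mul_apply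
  rw [e]
  exact DifferentiableOn.fun_sum fun k _ => (hL i k).mul (hQ k j)

/-- **σ-HOLOMORPHY OF THE Γ-KERNEL FROM THAT OF `K` AND ONE ACCRETIVITY CONSTANT** (the `hGhol` letter of the N10
record junctions; print p. 15: *"The quadratic forms and covariances in H(Z) are analytic functions …"*, with the
square root (2.7)): on the σ-ball `‖σ‖ < ϱ` of a complex normed parameter space, if `K(σ)` is entrywise holomorphic
and UNIFORMLY `m`-accretive with one `m > 0`, then every entry of `σ ↦ fromCols 0 (K σ).toBlocks₁₂ · invSqrt (K σ)` is
holomorphic — `B13Sqrt27Accretive.differentiableOn_invSqrt_apply` (holomorphy of the resolvent integral (2.7) by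
dominated convergence) in the σ-variable, times the off-diagonal block, summed over the finite bond set.
[cite: Balaban1988RG2Cluster, (2.7) p.13, (2.14) p.15] -/
theorem differentiableOn_offBlock_mul_invSqrt_apply [DecidableEq Λ] [DecidableEq C₀]
    (K : P → Matrix (Λ ⊕ C₀) (Λ ⊕ C₀) ℂ) {ϱ m : ℝ} (hm : 0 < m)
    (hacc : ∀ σ ∈ ball (0 : P) ϱ, ∀ v : Λ ⊕ C₀ → ℂ,
      m * ∑ i, ‖v i‖ ^ 2 ≤ (∑ i, star (v i) * (K σ *ᵥ v) i).re)
    (hK : ∀ k l, DifferentiableOn ℂ (fun σ => K σ k l) (ball (0 : P) ϱ)) (i : Λ) (j : Λ ⊕ C₀) :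
    DifferentiableOn ℂ
      (fun σ => (Matrix.fromCols (0 : Matrix Λ Λ ℂ) (K σ).toBlocks₁₂ * invSqrt (K σ)) i j) (ball (0 : P) ϱ) := by
  refine differentiableOn_fromCols_mul_apply (fun i' k => ?_)
    (fun k l => differentiableOn_invSqrt_apply K hm hacc hK k l) i j
  cases k with
  | inl k =>
    simp only [offBlock_apply_inl]
    exact differentiableOn_const _
  | inr k =>
    simp only [offBlock_apply_inr]
    exact hK (Sum.inl i') (Sum.inr k)

/-- **THE JUNCTIONS' OPEN POLYDISC IS THE SUP-NORM BALL**: for `ϱ > 0` and a finite parameter index `ι`,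
`{σ : ι → ℂ | ∀ j, σ j ∈ ball 0 ϱ} = ball 0 ϱ` (`Metric.ball_pi`) — so the σ-holomorphy letters above, stated on the
ball of `ι → ℂ`, are the letters `hAhol`∕`hGhol` of `Summit…N10AtRecord11B13WalksRefHolo` on the open
`e^{κ₁⁺}`-polydisc (print's parameter domain `|s(Δ)| ≤ e^{κ₁}` of (1.11), opened). [cite: Balaban1988RG2Cluster, (1.11) p.5, p.15] -/
theorem setOf_forall_mem_ball_eq_ball {ι : Type} [Fintype ι] {ϱ : ℝ} (hϱ : 0 < ϱ) :
    {σ : ι → ℂ | ∀ j, σ j ∈ ball (0 : ℂ) ϱ} = ball (0 : ι → ℂ) ϱ := by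
  rw [ball_pi (0 : ι → ℂ) hϱ]
  ext σ
  simp only [Set.mem_setOf_eq, Set.mem_pi, Set.mem_univ, true_implies, Pi.zero_apply]

end Letters

/-! ## §5. At the letters of ONE reference package: the rung and the accretivity of `K` on polydisc × ball -/

section AtPackage

variable {c : B13.Consts}

/-- **THE RUNG AT THE LETTERS OF A REFERENCE PACKAGE** (the consumer form of `termWalksRef_of_conditionedBlocks` for the
N10 record junctions, which carry ONE `rf : RefPackage`): the block reading, `X ≠ ∅`, ONE joint walk expansion of `K`
at the package's FULL-PRECISION letters `(rf.R, rf.ε_P, rf.κ_P, rf.K̄_P)`, `rf.m₀`-positivity of `Re K(0,0)`,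
far-ness `rf.R_σ`, multiplicity `rf.n_B`, dimension `≤ rf.d_m`, and a package whose local-factor and term-precision
slots are dominated by its full-precision slot (`rf.ε_L, rf.ε_A ≤ rf.ε_P`, `rf.κ_L, rf.κ_A ≤ rf.κ_P`, `rf.K̄_P ≤ rf.K̄_L,
rf.K̄_A`, `rf.m_{A,0} ≤ rf.m₀`) give `TermWalksRef 𝒦 rf`.
[cite: Balaban1988RG2Cluster, (2.5)–(2.7) pp.12–13, (2.14) p.15; Balaban1985BackgroundPropagators, Thm 3.10 p.416, Thm 3.12 p.423] -/
theorem termWalksRef_of_conditionedBlocks_at {𝒦 : TermKernels c d N' ν Nf E} [Fintype 𝒦.C₀] [DecidableEq 𝒦.C₀]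
    {K : (TPt d N' → ℂ) → E → Matrix (𝒦.Λ ⊕ 𝒦.C₀) (𝒦.Λ ⊕ 𝒦.C₀) ℂ}
    (hA2 : ∀ σ u, 𝒦.A2 σ u = (K σ u).toBlocks₁₁)
    (hG2 : ∀ σ u, 𝒦.G2 σ u = Matrix.fromCols (0 : Matrix 𝒦.Λ 𝒦.Λ ℂ) (K σ u).toBlocks₁₂ * invSqrt (K σ u))
    (hloc : ∀ i, 𝒦.locΛ i = 𝒦.locN (Sum.inl i))
    (hX : 𝒦.X.Nonempty) (rf : RefPackage) (hrf : rf.Admissible)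
    {W : Type} {T : W → (TPt d N' → ℂ) → E → Matrix (𝒦.Λ ⊕ 𝒦.C₀) (𝒦.Λ ⊕ 𝒦.C₀) ℂ}
    {SX : Set W} {A : W → ℝ} {D : W → UT Nf → UT Nf → ℝ} {ρ : ℝ}
    (hK : JointWalkExpansion c 𝒦.locN 𝒦.locN K 𝒦.X rf.R rf.εP rf.kapP rf.KbarP T SX A D ρ)
    (hacc : ∀ v : 𝒦.Λ ⊕ 𝒦.C₀ → ℂ, rf.m₀ * ∑ i, ‖v i‖ ^ 2 ≤ (∑ i, star (v i) * (K 0 0 *ᵥ v) i).re)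
    (hfar : ∀ k : 𝒦.Λ ⊕ 𝒦.C₀, ∀ z ∈ 𝒦.X, rf.Rσ ≤ tdist1 Nf (𝒦.locN k) z)
    (hmult : ∀ x : UT Nf, (Finset.univ.filter fun k : 𝒦.Λ ⊕ 𝒦.C₀ => 𝒦.locN k = x).card ≤ rf.nB)
    (hdim : ν ≤ rf.dm)
    (hεL : rf.εL ≤ rf.εP) (hκL : rf.kapL ≤ rf.kapP) (hKL : rf.KbarP ≤ rf.KbarL)
    (hεA : rf.εA ≤ rf.εP) (hκA : rf.kapA ≤ rf.kapP) (hKA : rf.KbarP ≤ rf.KbarA) (hmA : rf.mA₀ ≤ rf.m₀) :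
    TermWalksRef 𝒦 rf :=
  termWalksRef_of_conditionedBlocks hA2 hG2 hloc hX hK hrf.hKbarP hacc hfar hmult hdim rf le_rfl hεL hκL hKL
    le_rfl le_rfl le_rfl hεA hκA hKA le_rfl hmA le_rfl le_rfl le_rfl

/-- **ACCRETIVITY OF `K` ON POLYDISC × BALL FROM ITS ONE EXPANSION AND REFERENCE POSITIVITY** (print p. 15 ∕ (2.16):
*"The general case is handled by a perturbative argument"* — for the ONE operator, in the threshold form of
`NodeOLettersOfWalksPerturbative.termWalks_of_ref_thresholds`): the expansion of `K` at `(rf.R, rf.ε_P, rf.κ_P,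
rf.K̄_P)`, `rf.m₀`-positivity of `Re K(0,0)`, far-ness `rf.R_σ`, multiplicity `rf.n_B`, dimension `≤ rf.d_m`, a radius
`0 ≤ R₁ < rf.R` and print's two perturbative sources as the thresholds `8K̄_Pc_V₀e^{−ε_PR_σ} ≤ m₀`, `8K̄_Pc_V₀R₁ ≤ m₀R`
give `Re K(σ,u) ≥ m₀/2` for every `σ` of the closed `e^{κ₁}`-polydisc and `‖u‖ ≤ R₁` — the uniform accretivity that
`differentiableOn_offBlock_mul_invSqrt_apply` consumes (volume sum at the rate `κ_P/2` from the multiplicity,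
`volume_of_multiplicity`; the margin from the thresholds, `margin_of_thresholds`; then
`accretive_of_jointWalkExpansion_far`).
[cite: Balaban1988RG2Cluster, (2.7) p.13, p.15, (2.16) p.16; Balaban1985BackgroundPropagators, Thm 3.10 p.416, Thm 3.12 p.423; Balaban1984PropagatorsII, Lemma 2.1 (2.61) p.234] -/
theorem accretive_of_conditionedBlocks_at {Λ C₀ : Type} [Fintype Λ] [Fintype C₀] {locN : Λ ⊕ C₀ → UT Nf}
    {K : (TPt d N' → ℂ) → E → Matrix (Λ ⊕ C₀) (Λ ⊕ C₀) ℂ} {X : Finset (UT Nf)} (rf : RefPackage) (hrf : rf.Admissible)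
    {W : Type} {T : W → (TPt d N' → ℂ) → E → Matrix (Λ ⊕ C₀) (Λ ⊕ C₀) ℂ}
    {SX : Set W} {A : W → ℝ} {D : W → UT Nf → UT Nf → ℝ} {ρ : ℝ}
    (hK : JointWalkExpansion c locN locN K X rf.R rf.εP rf.kapP rf.KbarP T SX A D ρ)
    (hacc : ∀ v : Λ ⊕ C₀ → ℂ, rf.m₀ * ∑ i, ‖v i‖ ^ 2 ≤ (∑ i, star (v i) * (K 0 0 *ᵥ v) i).re)
    (hfar : ∀ k : Λ ⊕ C₀, ∀ z ∈ X, rf.Rσ ≤ tdist1 Nf (locN k) z)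
    (hmult : ∀ x : UT Nf, (Finset.univ.filter fun k : Λ ⊕ C₀ => locN k = x).card ≤ rf.nB)
    (hdim : ν ≤ rf.dm) {R₁ : ℝ} (hR₁ : 0 ≤ R₁) (hR₁R : R₁ < rf.R)
    (hPσ : 8 * rf.KbarP * rf.cV₀ * Real.exp (-(rf.εP * rf.Rσ)) ≤ rf.m₀) (hP₁ : 8 * rf.KbarP * rf.cV₀ * R₁ ≤ rf.m₀ * rf.R)
    (σ : TPt d N' → ℂ) (hσ : ∀ j, ‖σ j‖ ≤ Real.exp c.κ₁) {u : E} (hu : ‖u‖ ≤ R₁) (v : Λ ⊕ C₀ → ℂ) :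
    rf.m₀ / 2 * ∑ i, ‖v i‖ ^ 2 ≤ (∑ i, star (v i) * (K σ u *ᵥ v) i).re := by
  have hkP2 : 0 < rf.kapP / 2 := by linarith [hrf.hkapP]
  have hvol : ∀ i : Λ ⊕ C₀, ∑ k : Λ ⊕ C₀, Real.exp (-(rf.kapP / 2 * tdist1 Nf (locN i) (locN k))) ≤ rf.cV₀ :=
    fun i => NodeOLettersOfWalksPerturbative.volume_of_multiplicity locN hmult hkP2 hdim (locN i)
  have hmain := NodeOLettersOfWalksPerturbative.accretive_of_jointWalkExpansion_far hK hrf.hR hrf.hεP hrf.hKbarP (κ := rf.kapP / 2)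
    (by linarith [hrf.hkapP]) hfar hacc (RefPackage.cV₀_nonneg hrf) hvol hR₁ hR₁R σ hσ hu v
  have hmargin := NodeOLettersOfWalksPerturbative.margin_of_thresholds hrf.hR hPσ hP₁
  have hS : 0 ≤ ∑ i, ‖v i‖ ^ 2 := Finset.sum_nonneg fun i _ => by positivity
  exact le_trans (mul_le_mul_of_nonneg_right (by linarith) hS) hmain

end AtPackage

end Literature.MathematicalPhysics.QuantumFieldTheory.Balaban1983to89.B13ConditioningBlockWalks

end
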